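import Summits.Parity.GeneralizedHardyLittlewood.Theorems.LeeYangFibresRelativeDimOneDefs
import Summits.Parity.GeneralizedHardyLittlewood.Theorems.LeeYangFibresRelativeDimOneTightness
import Summits.Parity.GeneralizedHardyLittlewood.Theorems.LeeYangFibresRelativeDimOneLocalAverage
import Summits.Parity.GeneralizedHardyLittlewood.Theorems.LeeYangFibresRelativeDimOneSingularTail
import Summits.Parity.GeneralizedHardyLittlewood.Theorems.LeeYangFibresRelativeDimOneDegenerateCount
import Summits.Parity.GeneralizedHardyLittlewood.Theorems.LeeYangFibresRelativeDimOneArchFacts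
import Summits.Parity.GeneralizedHardyLittlewood.Theorems.LeeYangFibresRelativeDimOneSingularMeanGlue
import Summits.Parity.GeneralizedHardyLittlewood.Theorems.LeeYangFibresRelativeDimOneAmplification
import HarnessLib

/-!
# Route `LeeYangFibres`, crux `RelativeDimOne` (stmt-Parity-14113), line `SketchIdeator1` =
`translate-amplification`: the crux is EQUIVALENT to coarse two-sided Hardy–Littlewood

The capstone of the line, sorry-free over the landed stubs:

* `singularMean : SingularMean` — **Gallagher averaging for translate-constellations, unconditional**:
  for every `m, t ≥ 1, L, ε`, eventually in `N` and uniformly over non-degenerate one-dimensional systems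
  `Ψ` of `t` forms with `‖Ψ‖_N ≤ L` and convex `K ⊆ [-N, N]`, the main terms
  `β_∞(Ψ^{(H)}, K_H) 𝔖(Ψ^{(H)})` of the non-degenerate translate-constellations
  `Ψ^{(H)} = Ψ ⊔ (Ψ+H₁) ⊔ ⋯ ⊔ (Ψ+H_m)`, `H ∈ [-2N, 2N]^m`, sum to `(β_∞(Ψ,K) 𝔖(Ψ))^{m+1}` up to
  `ε ((β_∞𝔖)^{m+1} + N^{m+1})` — the glue `stub_singularMeanGlue` applied to `stub_localAverage`,
  `stub_singularTail`, `stub_degenerateCount`, `stub_archFacts`;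
* `relativeDimOne_of_coarseHLSlack : CoarseHLSlack → RelativeDimOne` — the transfer `stub_amplification`
  with all provable inputs discharged (`completeSum`, `singularMean`, `stub_degenerateCount`);
* **`relativeDimOne_iff_coarseHLSlack : RelativeDimOne ↔ CoarseHLSlack`** — exact uniform
  Hardy–Littlewood asymptotics at `d = 1` with Green–Tao's relative error (the crux) are EQUIVALENT to
  two-sided order-of-magnitude bounds `e^{-g(T)} β_∞𝔖 − ηN ≤ S ≤ e^{g(T)} β_∞𝔖 + ηN` for non-degenerate
  `T`-systems with ANY loss `g(T) = o(T)` in the number of forms: inside any framework that produces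
  two-sided bounds for prime constellations at all, sharp constants are provably unnecessary
  (tensor-power trick over translate-constellations; the other direction is `coarseHLSlack_of_relativeDimOne`).

The atom `CoarseHLSlack` itself is of open-problem strength (it implies the crux, hence the twin prime
conjecture: `Theorems/LeeYangFibresRelativeDimOne.twinPrimeConjecture_of_relativeDimOne`); nothing here
asserts it.
-/

noncomputable section

namespace Summit.Parity.GeneralizedHardyLittlewood.Cruxes.RelativeDimOne.TranslateAmplification

open Summit.Parity.GeneralizedHardyLittlewood.Theses.LeeYangFibres (RelativeDimOne)

/-- **B2 — Gallagher averaging for translate-constellations, unconditional**: the glue applied to the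
four landed stubs (local averages, uniform singular-product tails, degenerate-shift count, archimedean
weights). -/
theorem singularMean : SingularMean :=
  stub_singularMeanGlue stub_localAverage stub_singularTail stub_degenerateCount stub_archFacts

/-- The transfer with all its provable inputs discharged: the atom implies the crux. -/
theorem relativeDimOne_of_coarseHLSlack : CoarseHLSlack → RelativeDimOne :=
  fun h => stub_amplification completeSum singularMean stub_degenerateCount h

/-- **The crux is EQUIVALENT to coarse two-sided Hardy–Littlewood with sub-exponential dimension loss
and `o(N)` slack** (registered sub-goal of stmt-Parity-14113): `RelativeDimOne ↔ CoarseHLSlack`. -/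
theorem relativeDimOne_iff_coarseHLSlack : RelativeDimOne ↔ CoarseHLSlack :=
  ⟨coarseHLSlack_of_relativeDimOne, relativeDimOne_of_coarseHLSlack⟩

end Summit.Parity.GeneralizedHardyLittlewood.Cruxes.RelativeDimOne.TranslateAmplification
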